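import Summits.BirchSwinnertonDyer.BirchSwinnertonDyer.Theorems.KimAtThreeSemiLocalTraceDualTwist
import Mathlib.FieldTheory.IsAlgClosed.Basic
import Mathlib.Analysis.Complex.Polynomial.Basic
import HarnessLib

/-!
# Route `KimAtThreeKolyvagin` (W2): the EULER TWIST `P_w = p − a·δ_w + δ_{w²}` acts invertibly on
# `ℚ_p ⊗ ℚ(ζ_m)` (`a ≠ ±(p+1)`), so the trace dual of `P_w⁻¹·L_int` is `P_{w⁻¹}·L_int`

Cell `bsd-addord`, seat `bsd-addord-w2-acc3` (PROGRAMME PART 1b row (3), gen 6); companion of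
`KimAtThreeSemiLocalTraceDualTwist` (sixth file of the trace-duality set);
`--supports stmt-BirchSwinnertonDyer-19679` (helper).  TOOL theorems only (no definition, no named fact,
no instance, no `sorry`); pure algebra; nothing about any curve is used or asserted; closes nothing.

WHY.  The rider (ii_τ) of seat w2-c4 gen 9's fine package (C1_τ) and its LATTICE LEMMA
(`exp*_ω(H¹(K,T)) = E_p(φ⁻¹)·𝒪_K`, `E_p(X) = 1 − (a_p/p)X + X²/p`, `K` unramified) read the semi-local
dual exponential on the Euler-factor lattice `(1 ⊗ P_w)·L_int`, `P_w = p − a_pδ_w + δ_{w²} ∈ ℤ_p[(ℤ/m)ˣ]`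
(`w = [p]⁻¹`, i.e. `σ_w = φ⁻¹`).  `KimAtThreeSemiLocalTraceDualTwist` reduces "the dual of `P⁻¹L` is
`P*·L`" to the SURJECTIVITY of `P` and `P*` on `ℚ_p ⊗ ℚ(ζ_m)`; this file proves it for the Euler twist:
`P_w = q(σ_w)` with `q = X² − aX + p`, `σ_w^N = 1` (`N = #(ℤ/m)ˣ`), and `q` is COPRIME to `X^N − 1`
because a common complex root `ζ` would have `|ζ| = 1`, forcing (with `ζ̄ = ζ⁻¹`) `ζ = ±1` and
`a = ±(p+1)` — excluded for every `a_p` in the Hasse range `|a_p| ≤ 2√p < p + 1`.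

* §1 `sq_sub_mul_add_ne_zero_of_pow_eq_one` — no root of unity is a root of `X² − aX + p` (`a ≠ ±(p+1)`);
  `isCoprime_eulerPoly_X_pow_sub_one` — `IsCoprime (X² − aX + p) (X^N − 1)` in `ℚ_p[X]`
  (`Polynomial.isCoprime_iff_aeval_ne_zero_of_isAlgClosed` over `ℂ`, then base change).
* §2 `eulerTwist_apply` — `Σ_g (P_w)_g • (1 ⊗ σ_g) v = p·v − a·σ_w v + σ_w(σ_w v)`;
  `coeff_eulerTwist_inv` — `(P_{w⁻¹})_g = (P_w)_{g⁻¹}` (`P_w* = P_{w⁻¹}`);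
  ★ `eulerTwist_bijective` — `v ↦ P_w·v` is a bijection of `ℚ_p ⊗ ℚ(ζ_m)` (`a ≠ ±(p+1)`).
* §3 ★★ `forall_norm_trace_eulerTwist_mul_le_one_iff` (`p ∤ m`, any `a`): `y ∈ (P_w·L)^∨ ↔ P_{w⁻¹}·y ∈ L`;
  ★★★ `forall_norm_trace_mul_le_one_iff_exists_eq_eulerTwist_inv` (`p ∤ m`, `a ≠ ±(p+1)`):
  **`(P_w⁻¹L)^∨ = P_{w⁻¹}·L`**, `P_w⁻¹L := {x : P_w·x ∈ L}`, `L = cycIntLattice p m` — the semi-local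
  "dual of `E_p(φ)⁻¹·𝒪` is `E_p(φ⁻¹)·𝒪`"; `…_of_natAbs_le` (the Hasse-range form `|a| ≤ p`).

HONEST LIMITS: pure algebra (the identification of `log_ω(E(K) ⊗ ℤ_p)` with the Euler-factor lattice and
the duality pairing are NOT here); `p ∤ m` for the duals.

References: [Kim2022StructureSelmer] Lemma 3.4, Cor. 3.5, the proof of Thm. 3.13; [Kato2004Asterisque]
(5.7.1), Thm. 9.7, Ex. 13.3; [BlochKato1990] Prop. 3.8; J. H. Silverman, *The Arithmetic of Elliptic
Curves* V.1.1 (Hasse) [folklore]; adjoints in `K[G]` for the trace form [folklore].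
-/

set_option autoImplicit false
-- the Theorems namespace of a single-conjunct summit repeats the summit name by design (D-0017)
set_option linter.dupNamespace false
-- `CyclotomicField m ℚ`'s two `ℚ`-algebra structures agree only up to unfolding (as in the sibling files)
set_option backward.isDefEq.respectTransparency false

noncomputable section

open scoped TensorProduct NumberField BigOperators
open NumberField IsDedekindDomain Polynomial
open Literature.NumberTheory.EllipticCurves.Kato2004.EulerSystemValues
open Summit.BirchSwinnertonDyer.Rank1Residual.GaloisImage
open Summit.BirchSwinnertonDyer.Rank1Residual.GaloisImage.GroupRingEval
open Summit.BirchSwinnertonDyer.BirchSwinnertonDyer.Theorems.KimAtThreePortSharedSATCore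
open Summit.BirchSwinnertonDyer.BirchSwinnertonDyer.Theorems.KimAtThreeSemiLocalTraceDualCyc
open Summit.BirchSwinnertonDyer.BirchSwinnertonDyer.Theorems.KimAtThreeSemiLocalTraceDualTwist

namespace Summit.BirchSwinnertonDyer.BirchSwinnertonDyer.Theorems.KimAtThreeSemiLocalTraceDualTwistEuler

variable (m : ℕ) [NeZero m] (p : ℕ) [Fact p.Prime]

/-! ### §1 `X² − aX + p` and `X^N − 1` are coprime (`a ≠ ±(p+1)`) -/

omit [NeZero m] in
/-- **No root of unity is a root of `X² − aX + p`** unless `a = ±(p+1)`: if `z^N = 1` (`N ≠ 0`) then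
`|z| = 1`, `z̄ = z⁻¹`, and `z² − az + p = 0 = z̄² − az̄ + p` give `(p−1)(z̄² − 1) = 0`, so `z = ±1` and
`a = ±(p+1)`. [folklore] -/
theorem sq_sub_mul_add_ne_zero_of_pow_eq_one {a : ℤ} (ha : a ≠ (p : ℤ) + 1)
    (ha' : a ≠ -((p : ℤ) + 1)) {N : ℕ} (hN : N ≠ 0) {z : ℂ} (hz : z ^ N = 1) :
    z ^ 2 - (a : ℂ) * z + (p : ℂ) ≠ 0 := by
  intro h
  have hp1 : (p : ℂ) - 1 ≠ 0 := by
    intro h0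
    have h1 : (p : ℂ) = 1 := sub_eq_zero.mp h0
    have h2 : p = 1 := by exact_mod_cast h1
    exact (Fact.out : p.Prime).one_lt.ne' h2
  have hnorm : ‖z‖ = 1 := Complex.norm_eq_one_of_pow_eq_one hz hN
  have h3 : z * (starRingEnd ℂ) z = 1 := by
    rw [Complex.mul_conj, Complex.normSq_eq_norm_sq, hnorm]
    simp
  have h2 : (starRingEnd ℂ z) ^ 2 - (a : ℂ) * starRingEnd ℂ z + (p : ℂ) = 0 := by
    have hc := congrArg (starRingEnd ℂ) h
    rw [map_add, map_sub, map_mul, map_pow, map_intCast, map_natCast, map_zero] at hc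
    exact hc
  set c := starRingEnd ℂ z with hc
  have h4 : ((p : ℂ) - 1) * (c ^ 2 - 1) = 0 := by
    linear_combination c ^ 2 * h - h2 - (z * c + 1 - (a : ℂ) * c) * h3
  have hc2 : c ^ 2 - 1 = 0 := (mul_eq_zero.mp h4).resolve_left hp1
  have hc1 : c = 1 ∨ c = -1 := by
    have hf : (c - 1) * (c + 1) = 0 := by linear_combination hc2
    rcases mul_eq_zero.mp hf with h5 | h5
    · exact Or.inl (sub_eq_zero.mp h5)
    · exact Or.inr (eq_neg_of_add_eq_zero_left h5)
  rcases hc1 with h1 | h1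
  · have hz1 : z = 1 := by
      have h6 := h3
      rw [h1, mul_one] at h6
      exact h6
    rw [hz1] at h
    apply ha
    have h7 : (a : ℂ) = (p : ℂ) + 1 := by linear_combination -h
    exact_mod_cast h7
  · have hz1 : z = -1 := by
      have h6 := h3
      rw [h1] at h6
      linear_combination -h6
    rw [hz1] at h
    apply ha'
    have h7 : (a : ℂ) = -((p : ℂ) + 1) := by linear_combination h
    exact_mod_cast h7

omit [NeZero m] in
/-- **`X² − aX + p` is coprime to `X^N − 1` in `ℚ_p[X]`** (`a ≠ ±(p+1)`, `N ≠ 0`): over `ℂ` the two have no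
common root (`sq_sub_mul_add_ne_zero_of_pow_eq_one`), so they are coprime in `ℚ[X]`
(`Polynomial.isCoprime_iff_aeval_ne_zero_of_isAlgClosed`), and coprimality survives base change to `ℚ_p`.
[folklore] -/
theorem isCoprime_eulerPoly_X_pow_sub_one {a : ℤ} (ha : a ≠ (p : ℤ) + 1) (ha' : a ≠ -((p : ℤ) + 1))
    {N : ℕ} (hN : N ≠ 0) :
    IsCoprime (X ^ 2 - C ((a : ℤ) : ℚ_[p]) * X + C ((p : ℕ) : ℚ_[p]) : ℚ_[p][X]) (X ^ N - 1) := by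
  have hQ : IsCoprime (X ^ 2 - C ((a : ℤ) : ℚ) * X + C ((p : ℕ) : ℚ) : ℚ[X]) (X ^ N - 1) := by
    refine (Polynomial.isCoprime_iff_aeval_ne_zero_of_isAlgClosed ℚ ℂ _ _).2 fun z => ?_
    by_cases hz : z ^ N = 1
    · left
      have h := sq_sub_mul_add_ne_zero_of_pow_eq_one p ha ha' hN hz
      rwa [map_add, map_sub, map_mul, aeval_C, aeval_C, map_pow, aeval_X, map_intCast, map_natCast]
    · right
      rwa [map_sub, map_pow, aeval_X, map_one, sub_ne_zero]
  have h := hQ.map (Polynomial.mapRingHom (algebraMap ℚ ℚ_[p]))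
  simpa [Polynomial.coe_mapRingHom, Polynomial.map_sub, Polynomial.map_add, Polynomial.map_mul,
    Polynomial.map_pow, Polynomial.map_X, Polynomial.map_C, Polynomial.map_one] using h

/-! ### §2 The Euler twist `P_w = p − a·δ_w + δ_{w²}` on `ℚ_p ⊗ ℚ(ζ_m)` -/

/-- `Σ_g (δ_h·r)_g • f g = r • f h` for a monomial of `ℤ_p[(ℤ/m)ˣ]` read with `ℚ_p` coefficients.
[folklore] -/
theorem sum_coeff_single_coe_smul {V : Type*} [AddCommGroup V] [Module ℚ_[p] V]
    (h : (ZMod m)ˣ) (r : ℤ_[p]) (f : (ZMod m)ˣ → V) :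
    ∑ g : (ZMod m)ˣ, (((MonoidAlgebra.single h r).coeff g : ℤ_[p]) : ℚ_[p]) • f g =
      (r : ℚ_[p]) • f h := by
  classical
  have hc : ∀ g, (MonoidAlgebra.single h r).coeff g = if h = g then r else 0 := fun g => by
    rw [MonoidAlgebra.coeff_single, Finsupp.single_apply]
  simp_rw [hc]
  rw [Finset.sum_eq_single h (fun g _ hne => by rw [if_neg (Ne.symm hne), PadicInt.coe_zero, zero_smul])
    (fun hh => absurd (Finset.mem_univ h) hh), if_pos rfl]

/-- **The Euler twist evaluated**: for `P_w = p − a·δ_w + δ_{w²} ∈ ℤ_p[(ℤ/m)ˣ]` (the (ii_τ) element, with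
`a = a_p`), `Σ_g (P_w)_g • (1 ⊗ σ_g) v = p·v − a·(1 ⊗ σ_w)v + (1 ⊗ σ_w)((1 ⊗ σ_w) v)`. [folklore] -/
theorem eulerTwist_apply (w : (ZMod m)ˣ) (a : ℤ) (v : ℚ_[p] ⊗[ℚ] CyclotomicField m ℚ) :
    ∑ g : (ZMod m)ˣ, (((((p : ℕ) : MonoidAlgebra ℤ_[p] (ZMod m)ˣ) -
        MonoidAlgebra.single w (a : ℤ_[p]) + MonoidAlgebra.single (w ^ 2) (1 : ℤ_[p])).coeff g :
          ℤ_[p]) : ℚ_[p]) • Algebra.TensorProduct.map (AlgHom.id ℚ ℚ_[p])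
            (sigma m g : CyclotomicField m ℚ →ₐ[ℚ] CyclotomicField m ℚ) v =
      (p : ℚ_[p]) • v - (a : ℚ_[p]) • Algebra.TensorProduct.map (AlgHom.id ℚ ℚ_[p])
          (sigma m w : CyclotomicField m ℚ →ₐ[ℚ] CyclotomicField m ℚ) v +
        Algebra.TensorProduct.map (AlgHom.id ℚ ℚ_[p])
          (sigma m w : CyclotomicField m ℚ →ₐ[ℚ] CyclotomicField m ℚ)
          (Algebra.TensorProduct.map (AlgHom.id ℚ ℚ_[p])
            (sigma m w : CyclotomicField m ℚ →ₐ[ℚ] CyclotomicField m ℚ) v) := by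
  simp only [MonoidAlgebra.coeff_add, MonoidAlgebra.coeff_sub, Finsupp.add_apply, Finsupp.sub_apply,
    PadicInt.coe_add, PadicInt.coe_sub, add_smul, sub_smul, Finset.sum_add_distrib,
    Finset.sum_sub_distrib]
  have h1 := sum_coeff_single_coe_smul m p (1 : (ZMod m)ˣ) ((p : ℕ) : ℤ_[p])
    (fun g => Algebra.TensorProduct.map (AlgHom.id ℚ ℚ_[p])
      (sigma m g : CyclotomicField m ℚ →ₐ[ℚ] CyclotomicField m ℚ) v)
  have h2 := sum_coeff_single_coe_smul m p w (a : ℤ_[p])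
    (fun g => Algebra.TensorProduct.map (AlgHom.id ℚ ℚ_[p])
      (sigma m g : CyclotomicField m ℚ →ₐ[ℚ] CyclotomicField m ℚ) v)
  have h3 := sum_coeff_single_coe_smul m p (w ^ 2) (1 : ℤ_[p])
    (fun g => Algebra.TensorProduct.map (AlgHom.id ℚ ℚ_[p])
      (sigma m g : CyclotomicField m ℚ →ₐ[ℚ] CyclotomicField m ℚ) v)
  rw [MonoidAlgebra.natCast_def, h1, h2, h3, PadicInt.coe_natCast, PadicInt.coe_intCast, PadicInt.coe_one,
    one_smul, tensorSigma_one_apply, pow_two, tensorSigma_mul_apply]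

omit [NeZero m] in
/-- **`P_w* = P_{w⁻¹}`**: the coefficients of `P_{w⁻¹} = p − a·δ_{w⁻¹} + δ_{w⁻²}` are those of `P_w` read at
`g⁻¹`. [folklore] -/
theorem coeff_eulerTwist_inv (w : (ZMod m)ˣ) (a : ℤ) (g : (ZMod m)ˣ) :
    (((p : ℕ) : MonoidAlgebra ℤ_[p] (ZMod m)ˣ) - MonoidAlgebra.single w⁻¹ (a : ℤ_[p]) +
        MonoidAlgebra.single (w⁻¹ ^ 2) (1 : ℤ_[p])).coeff g =
      (((p : ℕ) : MonoidAlgebra ℤ_[p] (ZMod m)ˣ) - MonoidAlgebra.single w (a : ℤ_[p]) +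
        MonoidAlgebra.single (w ^ 2) (1 : ℤ_[p])).coeff g⁻¹ := by
  simp only [MonoidAlgebra.coeff_add, MonoidAlgebra.coeff_sub, Finsupp.add_apply, Finsupp.sub_apply,
    MonoidAlgebra.natCast_def, MonoidAlgebra.coeff_single, Finsupp.single_apply, inv_pow]
  have e1 : ((1 : (ZMod m)ˣ) = g) ↔ ((1 : (ZMod m)ˣ) = g⁻¹) := by
    rw [eq_comm, eq_comm (a := (1 : (ZMod m)ˣ)), inv_eq_one]
  have e2 : (w⁻¹ = g) ↔ (w = g⁻¹) := inv_eq_iff_eq_inv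
  have e3 : ((w ^ 2)⁻¹ = g) ↔ (w ^ 2 = g⁻¹) := inv_eq_iff_eq_inv
  simp only [e1, e2, e3]

/-- ★ **The Euler twist is a bijection of `ℚ_p ⊗ ℚ(ζ_m)`** (`a ≠ ±(p+1)`): `v ↦ Σ_g (P_w)_g • (1 ⊗ σ_g) v`
is `q(S)` for the `ℚ_p`-linear `S = 1 ⊗ σ_w` and `q = X² − aX + p`; `S^N = 1` (`N = #(ℤ/m)ˣ`), and a Bézout
relation `u·q + v·(X^N − 1) = 1` (§1) evaluated at `S` inverts `q(S)`. [folklore] -/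
theorem eulerTwist_bijective (w : (ZMod m)ˣ) {a : ℤ} (ha : a ≠ (p : ℤ) + 1)
    (ha' : a ≠ -((p : ℤ) + 1)) :
    Function.Bijective fun v : ℚ_[p] ⊗[ℚ] CyclotomicField m ℚ =>
      ∑ g : (ZMod m)ˣ, (((((p : ℕ) : MonoidAlgebra ℤ_[p] (ZMod m)ˣ) -
        MonoidAlgebra.single w (a : ℤ_[p]) + MonoidAlgebra.single (w ^ 2) (1 : ℤ_[p])).coeff g :
          ℤ_[p]) : ℚ_[p]) • Algebra.TensorProduct.map (AlgHom.id ℚ ℚ_[p])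
            (sigma m g : CyclotomicField m ℚ →ₐ[ℚ] CyclotomicField m ℚ) v := by
  classical
  obtain ⟨Ψ, hΨ⟩ := exists_monoidHom_eq_baseChange_sigma p m
  set S : Module.End ℚ_[p] (ℚ_[p] ⊗[ℚ] CyclotomicField m ℚ) := Ψ w with hS
  have hSv : ∀ v, S v = Algebra.TensorProduct.map (AlgHom.id ℚ ℚ_[p])
      (sigma m w : CyclotomicField m ℚ →ₐ[ℚ] CyclotomicField m ℚ) v := by
    intro v
    rw [hS, hΨ, baseChange_sigma_apply]
  set q : ℚ_[p][X] := X ^ 2 - C ((a : ℤ) : ℚ_[p]) * X + C ((p : ℕ) : ℚ_[p]) with hq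
  -- the twist is `aeval S q`
  have hT : ∀ v, (∑ g : (ZMod m)ˣ, (((((p : ℕ) : MonoidAlgebra ℤ_[p] (ZMod m)ˣ) -
        MonoidAlgebra.single w (a : ℤ_[p]) + MonoidAlgebra.single (w ^ 2) (1 : ℤ_[p])).coeff g :
          ℤ_[p]) : ℚ_[p]) • Algebra.TensorProduct.map (AlgHom.id ℚ ℚ_[p])
            (sigma m g : CyclotomicField m ℚ →ₐ[ℚ] CyclotomicField m ℚ) v) = aeval S q v := by
    intro v
    rw [eulerTwist_apply, hq, map_add, map_sub, map_mul, aeval_C, aeval_C, map_pow, aeval_X,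
      LinearMap.add_apply, LinearMap.sub_apply, Module.End.mul_apply, pow_two, Module.End.mul_apply,
      Module.algebraMap_end_apply, Module.algebraMap_end_apply, hSv, hSv]
    abel
  -- `S^N = 1`
  set N := Fintype.card (ZMod m)ˣ with hN
  have hN0 : N ≠ 0 := Fintype.card_ne_zero
  have hSN : aeval S (X ^ N - 1 : ℚ_[p][X]) = 0 := by
    rw [map_sub, map_pow, aeval_X, map_one, hS, ← map_pow, pow_card_eq_one, map_one, sub_self]
  -- Bézout
  obtain ⟨u, u', huv⟩ := isCoprime_eulerPoly_X_pow_sub_one p ha ha' hN0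
  have hUT : aeval S u * aeval S q = 1 := by
    have h := congrArg (aeval S) huv
    rwa [map_add, map_mul, map_mul, hSN, mul_zero, add_zero, map_one] at h
  have hTU : aeval S q * aeval S u = 1 := by
    rw [← map_mul, mul_comm, map_mul, hUT]
  have hfun : (fun v : ℚ_[p] ⊗[ℚ] CyclotomicField m ℚ =>
      ∑ g : (ZMod m)ˣ, (((((p : ℕ) : MonoidAlgebra ℤ_[p] (ZMod m)ˣ) -
        MonoidAlgebra.single w (a : ℤ_[p]) + MonoidAlgebra.single (w ^ 2) (1 : ℤ_[p])).coeff g :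
          ℤ_[p]) : ℚ_[p]) • Algebra.TensorProduct.map (AlgHom.id ℚ ℚ_[p])
            (sigma m g : CyclotomicField m ℚ →ₐ[ℚ] CyclotomicField m ℚ) v) = fun v => aeval S q v :=
    funext hT
  rw [hfun]
  refine ⟨Function.LeftInverse.injective (g := fun v => aeval S u v) fun v => ?_,
    Function.RightInverse.surjective (g := fun v => aeval S u v) fun v => ?_⟩
  · change (aeval S u * aeval S q) v = v
    rw [hUT, Module.End.one_apply]
  · change (aeval S q * aeval S u) v = v
    rw [hTU, Module.End.one_apply]

omit [Fact p.Prime] in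
/-- The Hasse-range form of the hypothesis: `|a| ≤ p` implies `a ≠ ±(p+1)`. [folklore] -/
theorem ne_and_ne_of_natAbs_le {a : ℤ} (ha : a.natAbs ≤ p) :
    a ≠ (p : ℤ) + 1 ∧ a ≠ -((p : ℤ) + 1) := by
  constructor
  · intro h; rw [h] at ha; omega
  · intro h; rw [h] at ha; omega

/-! ### §3 The twisted duals for the Euler twist -/

/-- ★★ **`y ∈ (P_w·L)^∨ ↔ P_{w⁻¹}·y ∈ L`** (`p ∤ m`, `L = cycIntLattice p m`, ANY `a`): for
`y ∈ ℚ_p ⊗ ℚ(ζ_m)`, `‖Tr((P_w·l)·y)‖ ≤ 1` for every `l ∈ L` iff `P_{w⁻¹}·y ∈ L` — the companion file's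
`forall_norm_trace_twist_mul_le_one_iff` with `P_w* = P_{w⁻¹}`.  In seat w2-c4 gen 9's language
(`w = [p]⁻¹`, `σ_w = φ⁻¹`): **`(E_p(φ⁻¹)·𝒪)^∨ = E_p(φ)⁻¹·𝒪`**.
[cite: Kim2022StructureSelmer, §3.4.1 and the proof of Thm. 3.13 (arXiv v3 pp. 26–28)] -/
theorem forall_norm_trace_eulerTwist_mul_le_one_iff (hpm : ¬ p ∣ m) (w : (ZMod m)ˣ) (a : ℤ)
    (y : ℚ_[p] ⊗[ℚ] CyclotomicField m ℚ) :
    (∀ l ∈ cycIntLattice p m, ‖Algebra.trace ℚ_[p] (ℚ_[p] ⊗[ℚ] CyclotomicField m ℚ)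
      ((∑ g : (ZMod m)ˣ, (((((p : ℕ) : MonoidAlgebra ℤ_[p] (ZMod m)ˣ) -
        MonoidAlgebra.single w (a : ℤ_[p]) + MonoidAlgebra.single (w ^ 2) (1 : ℤ_[p])).coeff g :
          ℤ_[p]) : ℚ_[p]) • Algebra.TensorProduct.map (AlgHom.id ℚ ℚ_[p])
            (sigma m g : CyclotomicField m ℚ →ₐ[ℚ] CyclotomicField m ℚ) l) * y)‖ ≤ 1) ↔
    ∑ g : (ZMod m)ˣ, (((((p : ℕ) : MonoidAlgebra ℤ_[p] (ZMod m)ˣ) -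
        MonoidAlgebra.single w⁻¹ (a : ℤ_[p]) + MonoidAlgebra.single (w⁻¹ ^ 2) (1 : ℤ_[p])).coeff g :
          ℤ_[p]) : ℚ_[p]) • Algebra.TensorProduct.map (AlgHom.id ℚ ℚ_[p])
            (sigma m g : CyclotomicField m ℚ →ₐ[ℚ] CyclotomicField m ℚ) y ∈ cycIntLattice p m := by
  simp_rw [coeff_eulerTwist_inv]
  exact forall_norm_trace_twist_mul_le_one_iff m p hpm (fun g => (((p : ℕ) : MonoidAlgebra ℤ_[p] (ZMod m)ˣ) -
    MonoidAlgebra.single w (a : ℤ_[p]) + MonoidAlgebra.single (w ^ 2) (1 : ℤ_[p])).coeff g) y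

/-- ★★★ **`(P_w⁻¹L)^∨ = P_{w⁻¹}·L`** (`p ∤ m`, `a ≠ ±(p+1)`; `L = cycIntLattice p m`,
`P_w⁻¹L := {x : P_w·x ∈ L}`): for `y ∈ ℚ_p ⊗ ℚ(ζ_m)`, `‖Tr(x·y)‖ ≤ 1` for every `x` with `P_w·x ∈ L`
iff `y = P_{w⁻¹}·z` for some `z ∈ L` — the companion file's ★★★ with the Euler twists' bijectivity.  In
seat w2-c4 gen 9's language this is the step "`log_ω(E(K) ⊗ ℤ_p) = E_p(φ)⁻¹·𝒪_K` ⟹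
`exp*_ω(H¹(K,T)) = (log_ω)^∨ = E_p(φ⁻¹)·𝒪_K` by trace duality" of the LATTICE LEMMA, in semi-local currency
and for general `p`, `m`, `a_p`. [cite: Kim2022StructureSelmer, Lemma 3.4, Cor. 3.5 and the proof of Thm. 3.13 (arXiv v3 pp. 17–18, 26–28)] -/
theorem forall_norm_trace_mul_le_one_iff_exists_eq_eulerTwist_inv (hpm : ¬ p ∣ m) (w : (ZMod m)ˣ)
    {a : ℤ} (ha : a ≠ (p : ℤ) + 1) (ha' : a ≠ -((p : ℤ) + 1)) (y : ℚ_[p] ⊗[ℚ] CyclotomicField m ℚ) :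
    (∀ x : ℚ_[p] ⊗[ℚ] CyclotomicField m ℚ,
      ∑ g : (ZMod m)ˣ, (((((p : ℕ) : MonoidAlgebra ℤ_[p] (ZMod m)ˣ) -
        MonoidAlgebra.single w (a : ℤ_[p]) + MonoidAlgebra.single (w ^ 2) (1 : ℤ_[p])).coeff g :
          ℤ_[p]) : ℚ_[p]) • Algebra.TensorProduct.map (AlgHom.id ℚ ℚ_[p])
            (sigma m g : CyclotomicField m ℚ →ₐ[ℚ] CyclotomicField m ℚ) x ∈ cycIntLattice p m →
        ‖Algebra.trace ℚ_[p] (ℚ_[p] ⊗[ℚ] CyclotomicField m ℚ) (x * y)‖ ≤ 1) ↔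
    ∃ z ∈ cycIntLattice p m, y = ∑ g : (ZMod m)ˣ, (((((p : ℕ) : MonoidAlgebra ℤ_[p] (ZMod m)ˣ) -
        MonoidAlgebra.single w⁻¹ (a : ℤ_[p]) + MonoidAlgebra.single (w⁻¹ ^ 2) (1 : ℤ_[p])).coeff g :
          ℤ_[p]) : ℚ_[p]) • Algebra.TensorProduct.map (AlgHom.id ℚ ℚ_[p])
            (sigma m g : CyclotomicField m ℚ →ₐ[ℚ] CyclotomicField m ℚ) z := by
  have hT := eulerTwist_bijective m p w ha ha'
  have hT' := eulerTwist_bijective m p w⁻¹ ha ha'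
  simp_rw [coeff_eulerTwist_inv] at hT' ⊢
  exact forall_norm_trace_mul_le_one_iff_exists_eq_twist m p hpm
    (fun g => (((p : ℕ) : MonoidAlgebra ℤ_[p] (ZMod m)ˣ) - MonoidAlgebra.single w (a : ℤ_[p]) +
      MonoidAlgebra.single (w ^ 2) (1 : ℤ_[p])).coeff g) hT.2 hT'.2 y

/-- **Hasse-range form** of ★★★: the same for every `a ∈ ℤ` with `|a| ≤ p` (so for every `a_p` of an
elliptic curve, `|a_p| ≤ 2√p ≤ p` for `p ≥ 5`, and `|a₃| ≤ 3`, `|a₂| ≤ 2`). [folklore] -/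
theorem forall_norm_trace_mul_le_one_iff_exists_eq_eulerTwist_inv_of_natAbs_le (hpm : ¬ p ∣ m)
    (w : (ZMod m)ˣ) {a : ℤ} (ha : a.natAbs ≤ p) (y : ℚ_[p] ⊗[ℚ] CyclotomicField m ℚ) :
    (∀ x : ℚ_[p] ⊗[ℚ] CyclotomicField m ℚ,
      ∑ g : (ZMod m)ˣ, (((((p : ℕ) : MonoidAlgebra ℤ_[p] (ZMod m)ˣ) -
        MonoidAlgebra.single w (a : ℤ_[p]) + MonoidAlgebra.single (w ^ 2) (1 : ℤ_[p])).coeff g :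
          ℤ_[p]) : ℚ_[p]) • Algebra.TensorProduct.map (AlgHom.id ℚ ℚ_[p])
            (sigma m g : CyclotomicField m ℚ →ₐ[ℚ] CyclotomicField m ℚ) x ∈ cycIntLattice p m →
        ‖Algebra.trace ℚ_[p] (ℚ_[p] ⊗[ℚ] CyclotomicField m ℚ) (x * y)‖ ≤ 1) ↔
    ∃ z ∈ cycIntLattice p m, y = ∑ g : (ZMod m)ˣ, (((((p : ℕ) : MonoidAlgebra ℤ_[p] (ZMod m)ˣ) -
        MonoidAlgebra.single w⁻¹ (a : ℤ_[p]) + MonoidAlgebra.single (w⁻¹ ^ 2) (1 : ℤ_[p])).coeff g :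
          ℤ_[p]) : ℚ_[p]) • Algebra.TensorProduct.map (AlgHom.id ℚ ℚ_[p])
            (sigma m g : CyclotomicField m ℚ →ₐ[ℚ] CyclotomicField m ℚ) z :=
  forall_norm_trace_mul_le_one_iff_exists_eq_eulerTwist_inv m p hpm w
    (ne_and_ne_of_natAbs_le p ha).1 (ne_and_ne_of_natAbs_le p ha).2 y

end Summit.BirchSwinnertonDyer.BirchSwinnertonDyer.Theorems.KimAtThreeSemiLocalTraceDualTwistEuler

end
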